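import Summits.QuantumAdvantage.AdviceFreeQNC0.AffBells28SubFibre
import HarnessLib

/-!
# Sketch28 §28.4b–§28.7 (planner qn-p1 g28, ROUND-27): the two-layer split `HIsoA → HIsoB → HIso`, the ASSEMBLY `polyLoss_of_iso` (PROVED),
# sanity instances; + the prover's discharge of the frame side

(VERBATIM copy of lines 296–439 of `HOME/qa-qnc0-p1/exp28/Sketch28.lean` (sha16 `b04adb4d7d167bef`), authored by the planner seat qn-p1 g28; landed by the
prover seat qn-prover-3 g14 (ask P-28a, port half, second file).  Only this paragraph and the corollary `polyLoss_of_iso'` at the end are new.)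

Contents: §28.4b `ClassIso`, `classIsoFrac`, `ClassIsoDense`, `HIsoA`, `HIsoB`, `hIso_of_AB` (PROVED); §28.5 `affWin_le_of_isoDense`,
**`polyLoss_of_iso : IsoRefutes → SubDoubleCount → HIso → AffFrameLoss → AffBellsPolyLoss3`** (PROVED); §28.7 three `decide`d sanity
`example`s.  **Net for the cell** (`polyLoss_of_iso'`, frame side discharged by the landed `AffBells27.affFrameLoss`): the (NP₁) rung
`AffBellsPolyLoss3` follows from `IsoRefutes` (⇐ `Peeling`, `PeelingList`, `Leaf`: P-28a), `SubDoubleCount` (P-28b) and the conjecture `HIso`.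
WHAT THIS IS NOT: none of those is proved here; separation NOT moved.
-/

namespace Summit.QuantumAdvantage.AdviceFreeQNC0

namespace AffBells28

open Finset Literature.Computability.QuantumComplexity Literature.Computability.QuantumComplexity.RingHLF
open AffBells23 AffBells26 Fib19 AffBells27

variable {N : ℕ}

/-! ### §28.4b The foreseen two-layer split of `HIso` (typed, both layers conjectural; `hIso_of_AB` PROVED)

`c` enters a witness only through the parities of the effective-offset counts, and NOT AT ALL when the isolated class is the single row `g₀`
with a three-valued leaf form.  Layer A is therefore pure `𝔽₃`-combinatorics of `β` against the kernel-line measure (no offsets, no game):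
CLASS ISOLATION is dense for far strategies.  Layer B is the parity step: class-isolable windows carry witnesses up to a polynomial loss
(automatic for singleton classes; for twin classes it is the statement that activity / off-leaf forms do not keep the signed counts balanced
on all but a negligible fraction).  The kit probe K-30 (exp28/isolate9.py) measures A (`iso_rate`, `U3`) and a proxy for B (`wit_rate_randoff`). -/

/-- `c`-FREE CLASS ISOLATION at the window `(x, C₀)`: flip patterns `x₁`, disjoint pair moves `L`, a set `S` of remaining coins and a surviving
reader `g₀` of `S` all of whose fellow surviving readers of `S` are local `±`-twins on `S`, with a THREE-VALUED `S`-form of `g₀` on `SubFibre x₁ S`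
(then for EVERY `c` the singleton-class case is a witness: counts `(1,0,0)` up to rotation; larger classes need the parity step, layer B). -/
def ClassIso (β : Fin N → Fin N → ZMod 3) (x : Fin N → Bool) (C₀ : Finset (Fin N)) : Prop :=
  ∃ x₁ ∈ SubFibre x C₀, ∃ L : List (Fin N × Fin N), MovesIn C₀ L ∧ ∃ S : Finset (Fin N), S ⊆ C₀ \ moveCoins L ∧
    ∃ g₀ ∈ readers β (surv β x x₁ L) S,
      (∀ h ∈ readers β (surv β x x₁ L) S, LocTwin β S h g₀ ∨ LocAnti β S h g₀) ∧
      ∀ t : ZMod 3, ∃ x' ∈ SubFibre x₁ S, leafForm β S x' g₀ = t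

open scoped Classical in
/-- Fraction of the `Z`-coin windows at `x` admitting a class isolation. -/
noncomputable def classIsoFrac (β : Fin N → Fin N → ZMod 3) (Z : ℕ) (x : Fin N → Bool) : ℝ :=
  ((((klineZeros x).powersetCard Z).filter fun C₀ => ClassIso β x C₀).card : ℝ) / (((klineZeros x).powersetCard Z).card : ℝ)

/-- `β` is `(δ, Z)`-CLASS-ISOLATION-DENSE. -/
def ClassIsoDense (δ : ℝ) (Z : ℕ) (β : Fin N → Fin N → ZMod 3) : Prop :=
  δ * (2 : ℝ) ^ (N - 1) ≤ ∑ x ∈ univ.filter (fun x : Fin N → Bool => IsOdd x), classIsoFrac β Z x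

/-- **Layer A (conjecture, `c`-free, game-free): far from every frame ⇒ class isolation is `N^{-a}`-dense at `K·log₂N` coins.**
Why it might fail: the BUDGET risk of `HIso` (moves must touch coins `g₀` reads). -/
def HIsoA : Prop :=
  ∃ δ₀ : ℝ, δ₀ < 1 / 2 ∧ ∃ r₀ w₀ a K N₀ : ℕ, ∀ N ≥ N₀, ∀ (β : Fin N → Fin N → ZMod 3),
    ¬ FrameDecomp δ₀ r₀ w₀ β → ClassIsoDense ((1 : ℝ) / (N : ℝ) ^ a) (K * Nat.log 2 N) β

/-- **Layer B (conjecture, the parity step): class-isolation density `N^{-a}` ⇒ loss `N^{-(a+b)}` outright or witness density `N^{-(a+b)}`.**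
Automatic (with `b = 0`, pointwise) where the isolated classes are singletons; content = twin classes are not kept balanced.
Why it might fail: a far twin-structured strategy whose twin groups sit at ring distances making `#(group ∩ active)` even on all but
`N^{-ω(1)}` of the kernel lines (activity is a hard-core-type measure; short-range parities are constants in `(0,1)`, so this needs long groups). -/
def HIsoB : Prop :=
  ∀ a K : ℕ, ∃ b N₀ : ℕ, ∀ N ≥ N₀, ∀ (β : Fin N → Fin N → ZMod 3) (c : Fin N → ZMod 3),
    ClassIsoDense ((1 : ℝ) / (N : ℝ) ^ a) (K * Nat.log 2 N) β →
      (affWinCard β c : ℝ) ≤ (1 - 1 / (N : ℝ) ^ (a + b)) * (2 : ℝ) ^ (N - 1) ∨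
        IsoDense ((1 : ℝ) / (N : ℝ) ^ (a + b)) (K * Nat.log 2 N) β c

/-- PROVED: the two layers give `HIso` (exponent `a + b`). -/
theorem hIso_of_AB (hA : HIsoA) (hB : HIsoB) : HIso := by
  obtain ⟨δ₀, hδ₀, r₀, w₀, a, K, N₀, hA'⟩ := hA
  obtain ⟨b, N₁, hB'⟩ := hB a K
  refine ⟨δ₀, hδ₀, r₀, w₀, a + b, K, max N₀ N₁, fun N hN β c hfar => ?_⟩
  exact hB' N (le_trans (le_max_right _ _) hN) β c (hA' N (le_trans (le_max_left _ _) hN) β hfar)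

/-! ### §28.5 Assembly (PROVED) -/

/-- Far side, one strategy: isolation density `1/N^a` at `Z = K·log₂N` coins ⇒ at most a `(1 − 1/N^{a+K})` fraction of the odd class is won. -/
theorem affWin_le_of_isoDense (hR : IsoRefutes) (hD : SubDoubleCount) (hN : 3 ≤ N) (a K : ℕ)
    (β : Fin N → Fin N → ZMod 3) (c : Fin N → ZMod 3) (h : IsoDense ((1 : ℝ) / (N : ℝ) ^ a) (K * Nat.log 2 N) β c) :
    (affWinCard β c : ℝ) ≤ (1 - 1 / (N : ℝ) ^ (a + K)) * (2 : ℝ) ^ (N - 1) := by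
  have hNpos : (0 : ℝ) < N := by exact_mod_cast (show 0 < N by omega)
  have hδ : (0 : ℝ) < 1 / (N : ℝ) ^ a := by positivity
  have key := hD hR N hN (K * Nat.log 2 N) _ β c hδ h
  have hlog : ((2 : ℕ) ^ Nat.log 2 N : ℝ) ≤ (N : ℝ) := by exact_mod_cast Nat.pow_log_le_self 2 (by omega : N ≠ 0)
  have h2Z : (2 : ℝ) ^ (K * Nat.log 2 N) ≤ (N : ℝ) ^ K := by
    rw [mul_comm, pow_mul]
    exact pow_le_pow_left₀ (by positivity) (by exact_mod_cast hlog) K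
  have hpos2 : (0 : ℝ) < (2 : ℝ) ^ (K * Nat.log 2 N) := by positivity
  have hmono : 1 / (N : ℝ) ^ a * (2 : ℝ) ^ (N - 1) / (N : ℝ) ^ K ≤ 1 / (N : ℝ) ^ a * (2 : ℝ) ^ (N - 1) / (2 : ℝ) ^ (K * Nat.log 2 N) :=
    div_le_div_of_nonneg_left (by positivity) hpos2 h2Z
  have hrw : 1 / (N : ℝ) ^ a * (2 : ℝ) ^ (N - 1) / (N : ℝ) ^ K = (2 : ℝ) ^ (N - 1) / (N : ℝ) ^ (a + K) := by
    rw [pow_add]; field_simp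
  have hrw2 : (1 - 1 / (N : ℝ) ^ (a + K)) * (2 : ℝ) ^ (N - 1) = (2 : ℝ) ^ (N - 1) - (2 : ℝ) ^ (N - 1) / (N : ℝ) ^ (a + K) := by
    field_simp
  rw [hrw2]
  rw [hrw] at hmono
  linarith [hmono.trans key]

/-- **ASSEMBLY of (NP₁) from the split (PROVED):** `e = a + K + 1`. -/
theorem polyLoss_of_iso (hR : IsoRefutes) (hD : SubDoubleCount) (hI : HIso) (hF : AffFrameLoss) : AffBellsPolyLoss3 := by
  obtain ⟨δ₀, hδ₀, r₀, w₀, a, K, N₀, hfar⟩ := hI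
  obtain ⟨θ, hθ, n₀, hn₀⟩ := hF δ₀ hδ₀ r₀ w₀
  obtain ⟨M, hM⟩ := exists_nat_gt (1 / (1 - θ))
  refine ⟨a + K + 1, max (max N₀ n₀) (max M 3), fun N hN β c => ?_⟩
  have hN₀ : N₀ ≤ N := le_trans (le_max_left _ _) (le_trans (le_max_left _ _) hN)
  have hn₀' : n₀ ≤ N := le_trans (le_max_right _ _) (le_trans (le_max_left _ _) hN)
  have hM' : M ≤ N := le_trans (le_max_left _ _) (le_trans (le_max_right _ _) hN)
  have h3 : 3 ≤ N := le_trans (le_max_right _ _) (le_trans (le_max_right _ _) hN)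
  have hNpos : (0 : ℝ) < N := by exact_mod_cast (show 0 < N by omega)
  have hN1 : (1 : ℝ) ≤ N := by exact_mod_cast (show 1 ≤ N by omega)
  have h2pow : (0 : ℝ) < (2 : ℝ) ^ (N - 1) := by positivity
  have hθ1 : 0 < 1 - θ := by linarith
  by_cases hdec : FrameDecomp δ₀ r₀ w₀ β
  · have hwin := hn₀ N hn₀' β c hdec
    have hMpos : (0 : ℝ) < M := by
      have : (0 : ℝ) < 1 / (1 - θ) := by positivity
      linarith
    have hinv : 1 / (N : ℝ) ≤ 1 - θ := by
      have h1 : 1 / (N : ℝ) ≤ 1 / (M : ℝ) := one_div_le_one_div_of_le hMpos (by exact_mod_cast hM')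
      have h2 : 1 / (M : ℝ) < 1 - θ := by
        rw [div_lt_iff₀ hMpos]
        have := (div_lt_iff₀ hθ1).mp hM
        linarith
      linarith
    have hpow : 1 / (N : ℝ) ^ (a + K + 1) ≤ 1 / (N : ℝ) := by
      apply one_div_le_one_div_of_le hNpos
      calc (N : ℝ) = (N : ℝ) ^ 1 := (pow_one _).symm
        _ ≤ (N : ℝ) ^ (a + K + 1) := pow_le_pow_right₀ hN1 (by omega)
    have : θ * (2 : ℝ) ^ (N - 1) ≤ (1 - 1 / (N : ℝ) ^ (a + K + 1)) * (2 : ℝ) ^ (N - 1) := by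
      apply mul_le_mul_of_nonneg_right _ h2pow.le
      linarith
    exact hwin.trans this
  · rcases hfar N hN₀ β c hdec with hlow | hiso
    · refine hlow.trans (mul_le_mul_of_nonneg_right ?_ h2pow.le)
      have hle : (N : ℝ) ^ a ≤ (N : ℝ) ^ (a + K + 1) := pow_le_pow_right₀ hN1 (by omega)
      have := one_div_le_one_div_of_le (by positivity) hle
      linarith
    · have hwin := affWin_le_of_isoDense hR hD h3 a K β c hiso
      refine hwin.trans (mul_le_mul_of_nonneg_right ?_ h2pow.le)
      have hle : (N : ℝ) ^ (a + K) ≤ (N : ℝ) ^ (a + K + 1) := pow_le_pow_right₀ hN1 (by omega)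
      have := one_div_le_one_div_of_le (by positivity) hle
      linarith

/-! ### §28.6 What the old window side becomes

`HWFar₀` (Sketch27 §27.4; windows = `log₂N + K` coins + three `win4` flip pairs, survivors = rows seeing all three) is NOT refuted and NOT
needed: the outer moves only THIN the row set (and make ≈ 70 % of the windows of a frame-like strategy EMPTY, qn-lit K-28), while pair flips
INSIDE a larger coin window thin just as well, see values (`dPair`), never leave the fibre, and need no `MoveSystem` validity, no cube
identity and no target drift.  Asks P-27c (port §27.2 + `DensityUpgradeWin` + general-move `CubeIdentityGen`) and P-27e are SUPERSEDED by
P-28a/b; P-27d (`CubeTargetEven`, qn-lit's file) stays a cheap instrument for the (NP₀) flip-cube sieve; P-27f (land FrameGlue) stays CRITICAL. -/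

/-! ### §28.7 Sanity instances (kernel-checked) -/

/-- A leaf form need not take all three values: with four coins the even-parity sums of `(1,1,1,2)` avoid the value `1` (so for a class `{g₀}`
with effective offset `1` this leaf carries no witness). -/
example : ∀ y : Fin 4 → Bool, (univ.filter fun i => y i = true).card % 2 = 0 →
    (∑ i, if y i then (![1, 1, 1, 2] : Fin 4 → ZMod 3) i else 0) ≠ 1 := by
  decide

/-- … while `(1,1,0)` on the even class of three coins takes all three values (two non-zero entries and a zero suffice). -/
example : ∀ t : ZMod 3, ∃ y : Fin 3 → Bool, (univ.filter fun i => y i = true).card % 2 = 0 ∧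
    (∑ i, if y i then (![1, 1, 0] : Fin 3 → ZMod 3) i else 0) = t := by
  decide

/-- Proportional rows are co-visible: no pair move separates `γ` from `2γ` (the named obstruction, instance `Z = 3`). -/
example : ∀ γ : Fin 3 → ZMod 3, ∀ i j : Fin 3, ∀ ε : ZMod 3, ε ≠ 0 →
    ((γ i + ε * γ j = 0) ↔ (2 * γ i + ε * (2 * γ j) = 0)) := by
  decide

/-- **(NP₁) from the isolation programme with the frame side discharged** (`AffBells27.affFrameLoss` is a tree theorem). -/
theorem polyLoss_of_iso' (hR : IsoRefutes) (hD : SubDoubleCount) (hI : HIso) : AffBellsPolyLoss3 :=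
  polyLoss_of_iso hR hD hI affFrameLoss

end AffBells28

end Summit.QuantumAdvantage.AdviceFreeQNC0
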